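import Literature.Topology.FourManifolds.SurfaceGroupNielsenCoreReduced
import Literature.GroupTheory.CombinatorialGroupTheory.NielsenTheorem
import HarnessLib

/-!
# Nielsen's theorem, pillar CORE: no doubly half-cancelled symbol in a minimal configuration

Topic `Literature/Topology/FourManifolds`.  Layer (P3) of the minimal-counterexample form of
Zieschang's homotopic shortening theorem (Zieschang–Vogt–Coldewey, LNM 835, Thm. 5.2.6 and
proof of Thm. 5.3.2), for the configurations `Config φ` of `SurfaceGroupNielsenCoreFrame.lean`
and their value words `Config.U` (`SurfaceGroupNielsenCoreReduced.lean`).  Let `κ` be a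
potential-minimal configuration of an indecomposable, marked non-trivial assignment, `y` the
`k`-th letter of its word with value `u` of length `2h`, and `ȳ` its partner (index `κ.bar k`,
value `u⁻¹`).  Then it is impossible that *both* `y` and `ȳ` lose exactly their first halves to
their cyclic predecessors (`not_both_first_halves`), and impossible that both lose exactly
their second halves to their cyclic successors (`not_both_second_halves`).

Proof (ZVC's use of the Lyndon–Schupp left-half weight, `norm_mul_eq_and_lexWeight_lt_or` of
`NielsenTheorem.lean`): with `a` the value of the predecessor `x` of `y` and `a'` that of the
predecessor `x'` of `ȳ`, the virtual triple `(a, u, z)`, `z = a'⁻¹`, has `k` letters cancelling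
in `a u` and in `u z` (`maxCancel_toWord_inv`) and at most half of `a`, `z` cancelling there
(the cyclic Nielsen property (N1) of a minimal configuration); so either `a u` has the length of
`a` and smaller weight — then the bifurcation "`x` absorbs `y`" (`exists_move_absorb_right`,
after rotating `κ` so that `x, y` are the first two letters) gives a related configuration with
the same closed-path length and smaller measure (`transport_pot_lt_of_single`), contradicting
minimality — or `u z = (a' u⁻¹)⁻¹` has the length of `z` and smaller weight, and "`x'` absorbs
`ȳ`" does.  The second-halves statement is the mirror image with successors and left
absorptions.

## References

* H. Zieschang, E. Vogt, H.-D. Coldewey, *Surfaces and Planar Discontinuous Groups*, LNM 835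
  (1980), §5.2 (Thm. 5.2.6, 5.2.7), §5.3 (proof of Thm. 5.3.2). [ZieschangVogtColdewey1980]
* R. C. Lyndon, P. E. Schupp, *Combinatorial Group Theory* (2001), Ch. I §2 (proof of
  Prop. 2.2). [LyndonSchupp2001]
-/

noncomputable section

namespace Literature.Topology.FourManifolds

open Literature.GroupTheory.CombinatorialGroupTheory List

namespace SurfaceGroup

variable {g : ℕ}

/-! ## Free-group and cyclic-index lemmas -/

/-- **The cancellation in `y⁻¹ x⁻¹` is the cancellation in `x y`.** [folklore] -/
theorem maxCancel_toWord_inv {ι : Type*} [DecidableEq ι] (x y : FreeGroup ι) :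
    maxCancel y⁻¹.toWord x⁻¹.toWord = maxCancel x.toWord y.toWord := by
  have h1 := norm_mul_eq y⁻¹ x⁻¹
  have h2 := norm_mul_eq x y
  rw [show y⁻¹ * x⁻¹ = (x * y)⁻¹ by group, FreeGroup.norm_inv_eq, FreeGroup.norm_inv_eq,
    FreeGroup.norm_inv_eq] at h1
  omega

/-- The factor at a cyclic index is the head of the corresponding rotation. [folklore] -/
theorem fac_eq_of_rotate_eq_cons {ι : Type*} {U : List (List (ι × Bool))} {j : ℕ}
    {X : List (ι × Bool)} {T : List (List (ι × Bool))} (h : U.rotate j = X :: T) :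
    CycFactors.fac U j = X := by
  have hlen : 0 < U.length := by
    rw [← length_rotate U j, h, length_cons]
    omega
  have h0 : (U.rotate j)[0]? = some X := by rw [h]; rfl
  rw [getElem?_rotate hlen, Nat.zero_add] at h0
  rw [CycFactors.fac, getD_eq_getElem?_getD, h0, Option.getD_some]

/-- The factor at the next cyclic index is the second entry of the rotation. [folklore] -/
theorem fac_succ_eq_of_rotate_eq_cons_cons {ι : Type*} {U : List (List (ι × Bool))} {j : ℕ}
    {X X' : List (ι × Bool)} {T : List (List (ι × Bool))} (h : U.rotate j = X :: X' :: T) :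
    CycFactors.fac U (j + 1) = X' := by
  have hlen : 1 < U.length := by
    rw [← length_rotate U j, h, length_cons, length_cons]
    omega
  have h1 : (U.rotate j)[1]? = some X' := by rw [h]; rfl
  rw [getElem?_rotate hlen, Nat.add_comm] at h1
  rw [CycFactors.fac, getD_eq_getElem?_getD, h1, Option.getD_some]

namespace Config

variable {φ : surfaceGen g → SurfaceGroup g}

/-! ## Relabelled values -/

/-- Relabelling preserves the length. [folklore] -/
theorem norm_relabel (x : FreeGroup (surfaceGen g)) : (relabel g x).norm = x.norm :=
  norm_freeGroupCongr _ x

/-- Relabelling preserves the maximal cancellation. [folklore] -/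
theorem maxCancel_toWord_relabel (x y : FreeGroup (surfaceGen g)) :
    maxCancel (relabel g x).toWord (relabel g y).toWord = maxCancel x.toWord y.toWord :=
  maxCancel_toWord_freeGroupCongr _ x y

/-- The relabelled assignment as a homomorphism is the relabelled lift. [folklore] -/
theorem lift_relabel_comp (Y : surfaceGen g → FreeGroup (surfaceGen g)) (v : FreeGroup (surfaceGen g)) :
    FreeGroup.lift (fun i => relabel g (Y i)) v = relabel g (FreeGroup.lift Y v) := by
  unfold relabel
  rw [lift_comp_freeGroupCongr]
  rfl

/-! ## Rotations and factors -/

/-- Every rotation of the word of a configuration of positive genus has at least two letters.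
[folklore] -/
theorem exists_rotate_eq_cons_cons (κ : Config φ) (hg : 1 ≤ g) (j : ℕ) :
    ∃ (x y : surfaceGen g × Bool) (R : List (surfaceGen g × Bool)), κ.w.rotate j = x :: y :: R := by
  have hlen : (κ.w.rotate j).length = 4 * g := by rw [length_rotate, length_w]
  match h : κ.w.rotate j, hlen with
  | [], hl => simp at hl; omega
  | [_], hl => simp at hl; omega
  | x :: y :: R, _ => exact ⟨x, y, R, rfl⟩

/-- **The factors at a cyclic index and its successor are the values of the first two letters
of the corresponding rotation.** [folklore] -/
theorem fac_of_rotate (κ : Config φ) {j : ℕ} {x y : surfaceGen g × Bool}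
    {R : List (surfaceGen g × Bool)} (hrot : κ.w.rotate j = x :: y :: R) :
    CycFactors.fac κ.U j = (FreeGroup.lift κ.Y (sgen x.1 x.2)).toWord ∧
      CycFactors.fac κ.U (j + 1) = (FreeGroup.lift κ.Y (sgen y.1 y.2)).toWord := by
  have hU : κ.U.rotate j =
      (κ.w.rotate j).map fun z => (FreeGroup.lift κ.Y (sgen z.1 z.2)).toWord := by
    rw [U, vals, map_map, map_rotate]
    rfl
  rw [hrot, map_cons, map_cons] at hU
  exact ⟨fac_eq_of_rotate_eq_cons hU, fac_succ_eq_of_rotate_eq_cons_cons hU⟩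

/-- No symbol is inessential, for an arbitrary rotation index. [cite: ZieschangVogtColdewey1980, 5.2.5] -/
theorem no_inessential' (κ : Config φ) (hI : Indecomposable φ) (k : ℕ) (x : surfaceGen g × Bool)
    (R : List (surfaceGen g × Bool)) : κ.w.rotate k ≠ x :: (x.1, !x.2) :: R := by
  intro h
  have hm : 0 < κ.w.length := by
    rw [← length_rotate κ.w k, h, length_cons]
    omega
  exact κ.no_inessential hI (k % κ.w.length) (Nat.mod_lt _ hm) x R (by rw [rotate_mod, h])

/-! ## A single bifurcation that does not increase the measure contradicts minimality -/

/-- **A move changing one value** `v = Ŷ(xᵢ^{±1})` into `m`, shorter or of the same length and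
smaller left-half weight (after relabelling), **lowers the potential**: the transported
configuration has the same closed-path length and smaller measure.
[cite: ZieschangVogtColdewey1980, Thm. 5.2.6 and proof of Thm. 5.3.2] -/
theorem transport_pot_lt_of_single (κ : Config φ) {w' : List (surfaceGen g × Bool)}
    {ψ : MulAut (FreeGroup (surfaceGen g))} {c₁ : FreeGroup (surfaceGen g)} {hperm : w' ~ κ.w}
    {hψ : ψ (FreeGroup.mk w') = c₁ * FreeGroup.mk κ.w * c₁⁻¹} (i₀ : surfaceGen g) (s : Bool)
    (hfix : ∀ i, i ≠ i₀ → ψ (FreeGroup.of i) = FreeGroup.of i) {m : FreeGroup (surfaceGen g)}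
    (hm : FreeGroup.lift κ.Y (ψ (sgen i₀ s)) = m)
    (h : (relabel g m).norm < (relabel g (FreeGroup.lift κ.Y (sgen i₀ s))).norm ∨
      ((relabel g m).norm = (relabel g (FreeGroup.lift κ.Y (sgen i₀ s))).norm ∧
        lexWeight (relabel g m) < lexWeight (relabel g (FreeGroup.lift κ.Y (sgen i₀ s))))) :
    (κ.transport w' ψ c₁ hperm hψ).pot < κ.pot := by
  set Xρ : surfaceGen g → FreeGroup (Fin (Fintype.card (surfaceGen g))) :=
    fun i => relabel g (κ.Y i) with hXρ
  set X'ρ : surfaceGen g → FreeGroup (Fin (Fintype.card (surfaceGen g))) :=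
    fun i => relabel g (FreeGroup.lift κ.Y (ψ (FreeGroup.of i))) with hX'ρ
  have hliftρ : ∀ v, FreeGroup.lift Xρ v = relabel g (FreeGroup.lift κ.Y v) :=
    fun v => lift_relabel_comp κ.Y v
  have hlift'ρ : ∀ v, FreeGroup.lift X'ρ v = relabel g (FreeGroup.lift κ.Y (ψ v)) := fun v => by
    have e : FreeGroup.lift X'ρ = (FreeGroup.lift Xρ).comp ψ.toMonoidHom :=
      FreeGroup.ext_hom _ _ fun i => by
        rw [FreeGroup.lift_apply_of, MonoidHom.comp_apply, MulEquiv.coe_toMonoidHom, hliftρ]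
    rw [e, MonoidHom.comp_apply, MulEquiv.coe_toMonoidHom, hliftρ]
  have hz : zMeasure X'ρ < zMeasure Xρ := by
    refine zMeasure_lt_of_single i₀ (fun i hi => ?_) ?_
    · simp only [hX'ρ, hXρ, hfix i hi, FreeGroup.lift_apply_of]
    · obtain ⟨hn, hl⟩ := norm_lexWeight_of_lift_sgen (X := X'ρ) (k := i₀) (s := s)
        (m := relabel g m) (by rw [hlift'ρ, hm])
      obtain ⟨hn₀, hl₀⟩ := norm_lexWeight_of_lift_sgen (X := Xρ) (k := i₀) (s := s)
        (m := relabel g (FreeGroup.lift κ.Y (sgen i₀ s))) (hliftρ _)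
      rw [hn, hl, hn₀, hl₀]
      exact h
  rw [transport_pot, pot]
  exact Prod.Lex.right _ hz

/-- **Right absorption test**: if `x, y` are the first two letters of `w`, `y` is not the partner
of `x`, and the value `a u` (of `x` after "`x` absorbs `y`") is shorter than `a`, or as long and
of smaller left-half weight, then some configuration has smaller potential.
[cite: ZieschangVogtColdewey1980, 5.2.4 and Thm. 5.2.6] -/
theorem exists_pot_lt_of_absorb_right (κ : Config φ) {x y : surfaceGen g × Bool}
    {R : List (surfaceGen g × Bool)} (hw : κ.w = x :: y :: R) (hxy : (x.1, !x.2) ≠ y)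
    (h : (relabel g (FreeGroup.lift κ.Y (sgen x.1 x.2)) * relabel g (FreeGroup.lift κ.Y (sgen y.1 y.2))).norm <
        (relabel g (FreeGroup.lift κ.Y (sgen x.1 x.2))).norm ∨
      ((relabel g (FreeGroup.lift κ.Y (sgen x.1 x.2)) * relabel g (FreeGroup.lift κ.Y (sgen y.1 y.2))).norm =
          (relabel g (FreeGroup.lift κ.Y (sgen x.1 x.2))).norm ∧
        lexWeight (relabel g (FreeGroup.lift κ.Y (sgen x.1 x.2)) * relabel g (FreeGroup.lift κ.Y (sgen y.1 y.2))) <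
          lexWeight (relabel g (FreeGroup.lift κ.Y (sgen x.1 x.2))))) :
    ∃ κ' : Config φ, κ'.pot < κ.pot := by
  have hw' : κ.w = [] ++ x :: ([] ++ y :: R) := hw
  obtain ⟨w', ψ, c, hperm, hψ, hfix, hval⟩ :=
    exists_move_absorb_right κ.isQuadratic_w hw' (not_mem_nil) hxy κ.Y (map_one _)
  refine ⟨κ.transport w' ψ c hperm hψ, κ.transport_pot_lt_of_single x.1 x.2 hfix hval ?_⟩
  rwa [map_mul]

/-- **Left absorption test**: if `x, y` are the first two letters of `w`, `x` is not the partner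
of `y`, and the value `a u` (of `y` after "`y` absorbs `x`") is shorter than `u`, or as long and
of smaller left-half weight, then some configuration has smaller potential.
[cite: ZieschangVogtColdewey1980, 5.2.4 and Thm. 5.2.6] -/
theorem exists_pot_lt_of_absorb_left (κ : Config φ) {x y : surfaceGen g × Bool}
    {R : List (surfaceGen g × Bool)} (hw : κ.w = x :: y :: R) (hyx : (y.1, !y.2) ≠ x)
    (h : (relabel g (FreeGroup.lift κ.Y (sgen x.1 x.2)) * relabel g (FreeGroup.lift κ.Y (sgen y.1 y.2))).norm <
        (relabel g (FreeGroup.lift κ.Y (sgen y.1 y.2))).norm ∨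
      ((relabel g (FreeGroup.lift κ.Y (sgen x.1 x.2)) * relabel g (FreeGroup.lift κ.Y (sgen y.1 y.2))).norm =
          (relabel g (FreeGroup.lift κ.Y (sgen y.1 y.2))).norm ∧
        lexWeight (relabel g (FreeGroup.lift κ.Y (sgen x.1 x.2)) * relabel g (FreeGroup.lift κ.Y (sgen y.1 y.2))) <
          lexWeight (relabel g (FreeGroup.lift κ.Y (sgen y.1 y.2))))) :
    ∃ κ' : Config φ, κ'.pot < κ.pot := by
  have hw' : κ.w = [] ++ x :: ([] ++ y :: R) := hw
  obtain ⟨w', ψ, c, hperm, hψ, hfix, hval⟩ :=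
    exists_move_absorb_left κ.isQuadratic_w hw' (not_mem_nil) hyx κ.Y (map_one _)
  refine ⟨κ.transport w' ψ c hperm hψ, κ.transport_pot_lt_of_single y.1 y.2 hfix hval ?_⟩
  rwa [map_mul]

/-! ## No doubly half-cancelled symbol -/

section Half

variable (κ : Config φ) (hI : Indecomposable φ) (hM : MarkedNontrivial φ) (hmin : κ.IsMin)
include hI hM hmin

/-- **No symbol has both its letters exactly half-cancelled by their predecessors** (ZVC, proof
of Thm. 5.3.2 with Thm. 5.2.6 (b); Lyndon–Schupp (N2) across the pairing): for the `k`-th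
letter `y` (value `u`, `|u| = 2h`) and its partner `ȳ` (index `κ.bar k`) it is impossible
that the predecessor of `y` cancels exactly `h` letters of `u` and the predecessor of `ȳ`
cancels exactly `h` letters of `u⁻¹`. [cite: ZieschangVogtColdewey1980, Thm. 5.2.6 and proof of Thm. 5.3.2] [cite: LyndonSchupp2001, Ch. I §2] -/
theorem not_both_first_halves {k : ℕ} (hk : k < κ.w.length) :
    ¬ (2 * CycFactors.jc κ.U (CycFactors.cpred κ.U k) = (CycFactors.fac κ.U k).length ∧
       2 * CycFactors.jc κ.U (CycFactors.cpred κ.U (κ.bar k)) = (CycFactors.fac κ.U k).length) := by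
  rintro ⟨h1, h2⟩
  have hg : 1 ≤ g := by have := κ.length_w; omega
  have hN := κ.cycNielsen_U hg hI hM hmin
  -- the letter `y` at `k` and its predecessor `x`
  obtain ⟨x, y, R, hrot⟩ := κ.exists_rotate_eq_cons_cons hg (CycFactors.cpred κ.U k)
  obtain ⟨hfa, hfu⟩ := κ.fac_of_rotate hrot
  rw [CycFactors.fac_cpred_succ] at hfu
  -- the partner `ȳ` at `κ.bar k` and its predecessor `x'`
  obtain ⟨x', y', R', hrot'⟩ := κ.exists_rotate_eq_cons_cons hg (CycFactors.cpred κ.U (κ.bar k))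
  obtain ⟨hfa', hfu'⟩ := κ.fac_of_rotate hrot'
  rw [CycFactors.fac_cpred_succ] at hfu'
  have hbar := κ.isPairing_bar.fac_bar k (by rw [length_U]; exact hk)
  -- notation for the values
  set a := FreeGroup.lift κ.Y (sgen x.1 x.2) with ha
  set u := FreeGroup.lift κ.Y (sgen y.1 y.2) with hu
  set a' := FreeGroup.lift κ.Y (sgen x'.1 x'.2) with ha'
  have hu' : FreeGroup.lift κ.Y (sgen y'.1 y'.2) = u⁻¹ := by
    apply FreeGroup.toWord_injective
    rw [← hfu', hbar, hfu, FreeGroup.toWord_inv]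
  -- the junction cancellations and lengths
  have hj1 : CycFactors.jc κ.U (CycFactors.cpred κ.U k) = maxCancel a.toWord u.toWord := by
    unfold CycFactors.jc
    rw [CycFactors.fac_cpred_succ, hfa, hfu]
  have hj2 : CycFactors.jc κ.U (CycFactors.cpred κ.U (κ.bar k)) = maxCancel a'.toWord u⁻¹.toWord := by
    unfold CycFactors.jc
    rw [CycFactors.fac_cpred_succ, hfa', hfu', hu']
  have hn : (CycFactors.fac κ.U k).length = u.norm := by rw [hfu]; rfl
  have hp1 := (hN.pair (CycFactors.cpred κ.U k)).1
  have hp2 := (hN.pair (CycFactors.cpred κ.U (κ.bar k))).1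
  rw [hj1, hfa] at hp1
  rw [hj2, hfa'] at hp2
  rw [hj1, hn] at h1
  rw [hj2, hn] at h2
  change 2 * maxCancel a.toWord u.toWord ≤ a.norm at hp1
  change 2 * maxCancel a'.toWord u⁻¹.toWord ≤ a'.norm at hp2
  -- the virtual triple `(a, u, a'⁻¹)`
  have hsymm : maxCancel u.toWord a'⁻¹.toWord = maxCancel a'.toWord u⁻¹.toWord := by
    have := maxCancel_toWord_inv a' u⁻¹
    rwa [inv_inv] at this
  have hu1 : u ≠ 1 := κ.val_ne_one hM y (κ.mem_w y)
  set κ₀ := maxCancel a.toWord u.toWord with hκ₀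
  rcases norm_mul_eq_and_lexWeight_lt_or (relabel g a) (relabel g u) (relabel g a'⁻¹) κ₀
      (by change (relabel g u).norm = 2 * κ₀; rw [norm_relabel]; omega)
      ((MulEquiv.map_ne_one_iff _).2 hu1)
      (by rw [maxCancel_toWord_relabel])
      (by rw [maxCancel_toWord_relabel, hsymm]; omega)
      (by change 2 * κ₀ ≤ (relabel g a).norm; rw [norm_relabel]; omega)
      (by change 2 * κ₀ ≤ (relabel g a'⁻¹).norm; rw [norm_relabel, FreeGroup.norm_inv_eq]; omega) with
    ⟨hnorm, hlex⟩ | ⟨hnorm, hlex⟩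
  · -- `x` absorbs `y` (in the rotation starting at `x`)
    have hxy : (x.1, !x.2) ≠ y := fun h =>
      κ.no_inessential' hI (CycFactors.cpred κ.U k) x R (by rw [hrot, ← h])
    obtain ⟨κ', hκ'⟩ := (κ.rotateCfg (CycFactors.cpred κ.U k)).exists_pot_lt_of_absorb_right
      (x := x) (y := y) (R := R) hrot hxy (by rw [rotateCfg_Y]; exact Or.inr ⟨hnorm, hlex⟩)
    exact hmin.rotateCfg _ κ' hκ'
  · -- `x'` absorbs `ȳ` (in the rotation starting at `x'`): the new value is `a' u⁻¹ = (u a'⁻¹)⁻¹`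
    have hxy : (x'.1, !x'.2) ≠ y' := fun h =>
      κ.no_inessential' hI (CycFactors.cpred κ.U (κ.bar k)) x' R' (by rw [hrot', ← h])
    have e : relabel g a' * relabel g u⁻¹ = (relabel g u * relabel g a'⁻¹)⁻¹ := by
      rw [map_inv, map_inv, mul_inv_rev, inv_inv]
    obtain ⟨κ', hκ'⟩ := (κ.rotateCfg (CycFactors.cpred κ.U (κ.bar k))).exists_pot_lt_of_absorb_right
      (x := x') (y := y') (R := R') hrot' hxy (by
        rw [rotateCfg_Y, hu']
        refine Or.inr ⟨?_, ?_⟩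
        · rw [← ha', e, FreeGroup.norm_inv_eq, hnorm, map_inv, FreeGroup.norm_inv_eq]
        · have e2 : lexWeight (relabel g a'⁻¹) = lexWeight (relabel g a') := by
            rw [map_inv, lexWeight_inv]
          rw [← ha', e, lexWeight_inv, ← e2]
          exact hlex)
    exact hmin.rotateCfg _ κ' hκ'

/-- **No symbol has both its letters exactly half-cancelled by their successors**: for the
`k`-th letter `y` (value `u`, `|u| = 2h`) and its partner `ȳ` it is impossible that the
successor of `y` cancels exactly `h` letters of `u` and the successor of `ȳ` cancels exactly
`h` letters of `u⁻¹`. [cite: ZieschangVogtColdewey1980, Thm. 5.2.6 and proof of Thm. 5.3.2] [cite: LyndonSchupp2001, Ch. I §2] -/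
theorem not_both_second_halves {k : ℕ} (hk : k < κ.w.length) :
    ¬ (2 * CycFactors.jc κ.U k = (CycFactors.fac κ.U k).length ∧
       2 * CycFactors.jc κ.U (κ.bar k) = (CycFactors.fac κ.U k).length) := by
  rintro ⟨h1, h2⟩
  have hg : 1 ≤ g := by have := κ.length_w; omega
  have hN := κ.cycNielsen_U hg hI hM hmin
  -- the letter `y` at `k` and its successor `s`
  obtain ⟨y, s, R, hrot⟩ := κ.exists_rotate_eq_cons_cons hg k
  obtain ⟨hfu, hfb⟩ := κ.fac_of_rotate hrot
  -- the partner `ȳ` at `κ.bar k` and its successor `s'`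
  obtain ⟨y', s', R', hrot'⟩ := κ.exists_rotate_eq_cons_cons hg (κ.bar k)
  obtain ⟨hfu', hfb'⟩ := κ.fac_of_rotate hrot'
  have hbar := κ.isPairing_bar.fac_bar k (by rw [length_U]; exact hk)
  -- notation for the values
  set u := FreeGroup.lift κ.Y (sgen y.1 y.2) with hu
  set b := FreeGroup.lift κ.Y (sgen s.1 s.2) with hb
  set b' := FreeGroup.lift κ.Y (sgen s'.1 s'.2) with hb'
  have hu' : FreeGroup.lift κ.Y (sgen y'.1 y'.2) = u⁻¹ := by
    apply FreeGroup.toWord_injective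
    rw [← hfu', hbar, hfu, FreeGroup.toWord_inv]
  -- the junction cancellations and lengths
  have hj1 : CycFactors.jc κ.U k = maxCancel u.toWord b.toWord := by
    unfold CycFactors.jc
    rw [hfu, hfb]
  have hj2 : CycFactors.jc κ.U (κ.bar k) = maxCancel u⁻¹.toWord b'.toWord := by
    unfold CycFactors.jc
    rw [hfu', hfb', hu']
  have hn : (CycFactors.fac κ.U k).length = u.norm := by rw [hfu]; rfl
  have hp1 := (hN.pair k).2
  have hp2 := (hN.pair (κ.bar k)).2
  rw [hj1, hfb] at hp1
  rw [hj2, hfb'] at hp2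
  rw [hj1, hn] at h1
  rw [hj2, hn] at h2
  change 2 * maxCancel u.toWord b.toWord ≤ b.norm at hp1
  change 2 * maxCancel u⁻¹.toWord b'.toWord ≤ b'.norm at hp2
  -- the virtual triple `(b'⁻¹, u, b)`
  have hsymm : maxCancel b'⁻¹.toWord u.toWord = maxCancel u⁻¹.toWord b'.toWord := by
    have := maxCancel_toWord_inv u⁻¹ b'
    rwa [inv_inv] at this
  have hu1 : u ≠ 1 := κ.val_ne_one hM y (κ.mem_w y)
  set κ₀ := maxCancel u.toWord b.toWord with hκ₀
  rcases norm_mul_eq_and_lexWeight_lt_or (relabel g b'⁻¹) (relabel g u) (relabel g b) κ₀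
      (by change (relabel g u).norm = 2 * κ₀; rw [norm_relabel]; omega)
      ((MulEquiv.map_ne_one_iff _).2 hu1)
      (by rw [maxCancel_toWord_relabel, hsymm]; omega)
      (by rw [maxCancel_toWord_relabel])
      (by change 2 * κ₀ ≤ (relabel g b'⁻¹).norm; rw [norm_relabel, FreeGroup.norm_inv_eq]; omega)
      (by change 2 * κ₀ ≤ (relabel g b).norm; rw [norm_relabel]; omega) with
    ⟨hnorm, hlex⟩ | ⟨hnorm, hlex⟩
  · -- `s'` absorbs `ȳ` (in the rotation starting at `ȳ`): the new value is `u⁻¹ b' = (b'⁻¹ u)⁻¹`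
    have hyx : (s'.1, !s'.2) ≠ y' := fun h =>
      κ.no_inessential' hI (κ.bar k) (s'.1, !s'.2) R' (by rw [hrot', ← h, Bool.not_not])
    have e : relabel g u⁻¹ * relabel g b' = (relabel g b'⁻¹ * relabel g u)⁻¹ := by
      rw [map_inv, map_inv, mul_inv_rev, inv_inv]
    obtain ⟨κ', hκ'⟩ := (κ.rotateCfg (κ.bar k)).exists_pot_lt_of_absorb_left
      (x := y') (y := s') (R := R') hrot' hyx (by
        rw [rotateCfg_Y, hu']
        refine Or.inr ⟨?_, ?_⟩
        · rw [← hb', e, FreeGroup.norm_inv_eq, hnorm, map_inv, FreeGroup.norm_inv_eq]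
        · have e2 : lexWeight (relabel g b'⁻¹) = lexWeight (relabel g b') := by
            rw [map_inv, lexWeight_inv]
          rw [← hb', e, lexWeight_inv, ← e2]
          exact hlex)
    exact hmin.rotateCfg _ κ' hκ'
  · -- `s` absorbs `y` (in the rotation starting at `y`)
    have hyx : (s.1, !s.2) ≠ y := fun h =>
      κ.no_inessential' hI k (s.1, !s.2) R (by rw [hrot, ← h, Bool.not_not])
    obtain ⟨κ', hκ'⟩ := (κ.rotateCfg k).exists_pot_lt_of_absorb_left
      (x := y) (y := s) (R := R) hrot hyx (by rw [rotateCfg_Y]; exact Or.inr ⟨hnorm, hlex⟩)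
    exact hmin.rotateCfg _ κ' hκ'

end Half

end Config

end SurfaceGroup

end Literature.Topology.FourManifolds

end
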